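import Literature.Computability.QuantumComplexity.RevGadgets
import Literature.Computability.QuantumComplexity.RevUncompute
import HarnessLib

/-!
# Exact reversible oracles for Boolean functions: the register layout and the Toffoli count

Topic `Literature/Computability/QuantumComplexity`. Vocabulary for the exact (zero-error)
synthesis of the standard oracle `U_f : |x⟩|y⟩|0^a⟩ ↦ |x⟩|y ⊕ f(x)⟩|0^a⟩` of a Boolean function
`f : {0,1}ⁿ → {0,1}` by a reversible circuit over `{NOT, CNOT, Toffoli}` (`RevOp`, `revEval`,
`revCompile` of `ReversibleCliffordT.lean`), as used by Gosset–Kothari–Wu 2024, Lemma 2.1 and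
Remark 2.2 (= Low–Kliuchnikov–Schaeffer 2024, Thm. 2): "By converting XOR gate into CNOT gate
(which is Clifford) and AND gate into Toffoli gate (which has a constant T-count), we can
synthesize `U_f` with T-count proportional to the number of AND gates" (arXiv:2411.04790, p. 8).

* `toffCount ops` — the number of Toffoli gates of a reversible circuit `ops : List (RevOp N)`
  (the cost: `NOT = HSSH` and `CNOT` compile to Clifford words, a Toffoli to a word with 7 `T`
  gates, `toffoliWord`);
* `layout x b : QReg (n + (1 + a))` — the register `address (n) ‖ target (1) ‖ ancillas (a)`
  holding `x`, `b`, `0^a`; the wires `addrWire n a i`, `tgtWire n a`, `ancWire n a j` and the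
  evaluation / update / injectivity lemmas of the layout.

* `boolOracle_exact` — **the oracle family itself** (Remark 2.2 = LKS24 Thm. 2, the multiplicative
  complexity bound): every `f` on `n = 2k` bits has an exact reversible circuit for `U_f` with clean
  ancillas and at most `8 · 2^k = O(2^{n/2})` Toffoli gates. Construction (sub-namespace
  `BoolOracle`): the `2^k` monomials `u^S` of the low half and `v^T` of the high half are computed
  into ancilla cells level by level (one Toffoli per monomial, `tableOps`), then for each `T` one
  Toffoli adds `v^T · g_T(u)` to the target where `g_T(u) = ⊕_{S : a_{S,T}=1} u^S` is XOR-ed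
  (CNOTs) into a scratch wire and un-XOR-ed (`blocks`), and the tables are undone by the reversed
  program; correctness is the two-block algebraic normal form
  `f(u,v) = ⊕_{S,T} a_{S,T} u^S v^T`, `a_{S,T} = ⊕_{S'⊆S, T'⊆T} f(1_{S'}, 1_{T'})` (Möbius inversion
  over the Boolean cube mod 2, `listXor_mono_anf`). Total `≤ 5 · 2^k` Toffoli gates.

The phase-kickback synthesis of sign states from such oracles is `SignStateKickbackSynthesis.lean`.

## References

* D. Gosset, R. Kothari, K. Wu, *Quantum state preparation with optimal T-count*,
  arXiv:2411.04790 (2024), Lemma 2.1 and Remark 2.2 (p. 8) [GossetKothariWu2024].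
* G. H. Low, V. Kliuchnikov, L. Schaeffer, *Trading T gates for dirty qubits in state preparation
  and unitary synthesis*, Quantum 8 (2024) 1375, Thm. 2 [LowKliuchnikovSchaeffer2024].
* M. A. Nielsen, I. L. Chuang, *Quantum Computation and Quantum Information*, CUP 2010, §3.2.5
  (reversible computation with Toffoli gates and ancillas) [NielsenChuang2010].
-/

namespace Literature.Computability.QuantumComplexity

open Cryptography

/-! ### The Toffoli count -/

/-- The number of Toffoli gates of a reversible circuit over `{NOT, CNOT, Toffoli}` — the `T`-cost
of its Clifford+`T` compilation ("AND gate into Toffoli gate (which has a constant T-count)").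
[cite: GossetKothariWu2024, Remark 2.2 (arXiv p. 8)] -/
def toffCount {N : ℕ} (ops : List (RevOp N)) : ℕ :=
  ops.countP fun op => match op with
    | .toffoli _ _ _ _ _ _ => true
    | _ => false

section ToffCount

variable {N : ℕ}

/-- The empty circuit has no Toffoli gate. [cite: GossetKothariWu2024, Remark 2.2 (arXiv p. 8)] -/
@[simp] theorem toffCount_nil : toffCount ([] : List (RevOp N)) = 0 := rfl

/-- A `NOT` gate does not count. [cite: GossetKothariWu2024, Remark 2.2 (arXiv p. 8)] -/
@[simp] theorem toffCount_cons_not (i : Fin N) (ops : List (RevOp N)) :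
    toffCount (RevOp.not i :: ops) = toffCount ops := by
  simp [toffCount]

/-- A `CNOT` gate does not count. [cite: GossetKothariWu2024, Remark 2.2 (arXiv p. 8)] -/
@[simp] theorem toffCount_cons_cnot (i j : Fin N) (h : i ≠ j) (ops : List (RevOp N)) :
    toffCount (RevOp.cnot i j h :: ops) = toffCount ops := by
  simp [toffCount]

/-- A Toffoli gate counts one. [cite: GossetKothariWu2024, Remark 2.2 (arXiv p. 8)] -/
@[simp] theorem toffCount_cons_toffoli (a b c : Fin N) (hab : a ≠ b) (hac : a ≠ c) (hbc : b ≠ c)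
    (ops : List (RevOp N)) :
    toffCount (RevOp.toffoli a b c hab hac hbc :: ops) = toffCount ops + 1 := by
  simp [toffCount]

/-- The Toffoli count is additive under concatenation. [cite: GossetKothariWu2024, Remark 2.2 (arXiv p. 8)] -/
@[simp] theorem toffCount_append (ops ops' : List (RevOp N)) :
    toffCount (ops ++ ops') = toffCount ops + toffCount ops' := by
  simp [toffCount, List.countP_append]

/-- The Toffoli count of a reversed circuit. [cite: GossetKothariWu2024, Remark 2.2 (arXiv p. 8)] -/
@[simp] theorem toffCount_reverse (ops : List (RevOp N)) :
    toffCount ops.reverse = toffCount ops := by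
  simp [toffCount, List.countP_reverse]

/-- The Toffoli count is at most the number of operations. [cite: GossetKothariWu2024, Remark 2.2 (arXiv p. 8)] -/
theorem toffCount_le_length (ops : List (RevOp N)) : toffCount ops ≤ ops.length :=
  List.countP_le_length

end ToffCount

/-! ### The register layout `address ‖ target ‖ ancillas` -/

section Layout

variable {n a : ℕ}

/-- The register layout `address (n) ‖ target (1) ‖ clean ancillas (a)`: the basis label
`x ‖ b ‖ 0^a` of `|x⟩|b⟩|0^a⟩`. [cite: GossetKothariWu2024, Lemma 2.1 (arXiv p. 8)] -/
def layout {n a : ℕ} (x : QReg n) (b : Bool) : QReg (n + (1 + a)) :=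
  Fin.append x (Fin.append (fun _ : Fin 1 => b) (fun _ : Fin a => false))

/-- The `i`-th address wire of the layout. [cite: GossetKothariWu2024, Lemma 2.1 (arXiv p. 8)] -/
def addrWire (n a : ℕ) (i : Fin n) : Fin (n + (1 + a)) := Fin.castAdd (1 + a) i

/-- The target wire of the layout. [cite: GossetKothariWu2024, Lemma 2.1 (arXiv p. 8)] -/
def tgtWire (n a : ℕ) : Fin (n + (1 + a)) := Fin.natAdd n (Fin.castAdd a (0 : Fin 1))

/-- The `j`-th ancilla wire of the layout. [cite: GossetKothariWu2024, Lemma 2.1 (arXiv p. 8)] -/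
def ancWire (n a : ℕ) (j : Fin a) : Fin (n + (1 + a)) := Fin.natAdd n (Fin.natAdd 1 j)

/-- The index of an address wire. [cite: GossetKothariWu2024, Lemma 2.1 (arXiv p. 8)] -/
@[simp] theorem addrWire_val (i : Fin n) : (addrWire n a i : ℕ) = i := rfl

/-- The index of the target wire. [cite: GossetKothariWu2024, Lemma 2.1 (arXiv p. 8)] -/
@[simp] theorem tgtWire_val : (tgtWire n a : ℕ) = n := by simp [tgtWire]

/-- The index of an ancilla wire. [cite: GossetKothariWu2024, Lemma 2.1 (arXiv p. 8)] -/
@[simp] theorem ancWire_val (j : Fin a) : (ancWire n a j : ℕ) = n + (1 + j) := by simp [ancWire]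

/-- Address wires are injective in the index. [cite: GossetKothariWu2024, Lemma 2.1 (arXiv p. 8)] -/
theorem addrWire_injective : Function.Injective (addrWire n a) := fun i j h => by
  simpa [Fin.ext_iff] using h

/-- Ancilla wires are injective in the index. [cite: GossetKothariWu2024, Lemma 2.1 (arXiv p. 8)] -/
theorem ancWire_injective : Function.Injective (ancWire n a) := fun i j h => by
  have := congrArg Fin.val h; simp [ancWire_val] at this; exact Fin.ext this

/-- An address wire is not the target wire. [cite: GossetKothariWu2024, Lemma 2.1 (arXiv p. 8)] -/
theorem addrWire_ne_tgtWire (i : Fin n) : addrWire n a i ≠ tgtWire n a := by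
  intro h; have := congrArg Fin.val h; simp at this; omega

/-- An address wire is not an ancilla wire. [cite: GossetKothariWu2024, Lemma 2.1 (arXiv p. 8)] -/
theorem addrWire_ne_ancWire (i : Fin n) (j : Fin a) : addrWire n a i ≠ ancWire n a j := by
  intro h; have := congrArg Fin.val h; simp at this; omega

/-- The target wire is not an ancilla wire. [cite: GossetKothariWu2024, Lemma 2.1 (arXiv p. 8)] -/
theorem tgtWire_ne_ancWire (j : Fin a) : tgtWire n a ≠ ancWire n a j := by
  intro h; have := congrArg Fin.val h; simp at this

/-- Every wire is an address wire, the target wire or an ancilla wire. [cite: GossetKothariWu2024, Lemma 2.1 (arXiv p. 8)] -/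
theorem wire_cases (w : Fin (n + (1 + a))) :
    (∃ i, w = addrWire n a i) ∨ w = tgtWire n a ∨ ∃ j, w = ancWire n a j := by
  induction w using Fin.addCases with
  | left i => exact Or.inl ⟨i, rfl⟩
  | right w =>
    induction w using Fin.addCases with
    | left l => exact Or.inr (Or.inl (by rw [Subsingleton.elim l 0]; rfl))
    | right j => exact Or.inr (Or.inr ⟨j, rfl⟩)

/-- The layout holds `x` on the address wires. [cite: GossetKothariWu2024, Lemma 2.1 (arXiv p. 8)] -/
@[simp] theorem layout_addrWire (x : QReg n) (b : Bool) (i : Fin n) :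
    layout (a := a) x b (addrWire n a i) = x i := by
  simp [layout, addrWire]

/-- The layout holds `b` on the target wire. [cite: GossetKothariWu2024, Lemma 2.1 (arXiv p. 8)] -/
@[simp] theorem layout_tgtWire (x : QReg n) (b : Bool) : layout (a := a) x b (tgtWire n a) = b := by
  simp [layout, tgtWire]

/-- The layout holds `0` on the ancilla wires. [cite: GossetKothariWu2024, Lemma 2.1 (arXiv p. 8)] -/
@[simp] theorem layout_ancWire (x : QReg n) (b : Bool) (j : Fin a) :
    layout x b (ancWire n a j) = false := by
  simp [layout, ancWire]

/-- Rewriting the target wire of a layout. [cite: GossetKothariWu2024, Lemma 2.1 (arXiv p. 8)] -/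
@[simp] theorem update_layout_tgtWire (x : QReg n) (b b' : Bool) :
    Function.update (layout (a := a) x b) (tgtWire n a) b' = layout x b' := by
  funext w
  rcases wire_cases w with ⟨i, rfl⟩ | rfl | ⟨j, rfl⟩
  · rw [Function.update_of_ne (addrWire_ne_tgtWire i), layout_addrWire, layout_addrWire]
  · rw [Function.update_self, layout_tgtWire]
  · rw [Function.update_of_ne (tgtWire_ne_ancWire j).symm, layout_ancWire, layout_ancWire]

/-- Two layouts agree iff their addresses and target bits agree. [cite: GossetKothariWu2024, Lemma 2.1 (arXiv p. 8)] -/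
theorem layout_inj {x x' : QReg n} {b b' : Bool} :
    layout (a := a) x b = layout x' b' ↔ x = x' ∧ b = b' := by
  constructor
  · intro h
    refine ⟨funext fun i => ?_, ?_⟩
    · have := congrFun h (addrWire n a i); simpa using this
    · have := congrFun h (tgtWire n a); simpa using this
  · rintro ⟨rfl, rfl⟩; rfl

/-- A basis label is a layout with target bit `b` iff its target wire holds `b` and its ancilla
wires hold `0`; the address is then read off the address wires. [cite: GossetKothariWu2024, Lemma 2.1 (arXiv p. 8)] -/
theorem eq_layout_iff (z : QReg (n + (1 + a))) (x : QReg n) (b : Bool) :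
    z = layout x b ↔ (fun i => z (addrWire n a i)) = x ∧ z (tgtWire n a) = b ∧
      ∀ j, z (ancWire n a j) = false := by
  constructor
  · rintro rfl
    exact ⟨funext fun i => layout_addrWire x b i, layout_tgtWire x b, layout_ancWire x b⟩
  · rintro ⟨rfl, hb, hanc⟩
    funext w
    rcases wire_cases w with ⟨i, rfl⟩ | rfl | ⟨j, rfl⟩
    · rw [layout_addrWire]
    · rw [layout_tgtWire, hb]
    · rw [layout_ancWire, hanc j]

/-- The all-zero label is the layout of the zero address with target bit `0`. [cite: GossetKothariWu2024, Lemma 2.1 (arXiv p. 8)] -/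
theorem zero_eq_layout : (fun _ => false : QReg (n + (1 + a))) = layout (fun _ => false) false :=
  (eq_layout_iff _ _ _).2 ⟨rfl, rfl, fun _ => rfl⟩

/-- Pointwise form of "the labels `x ‖ b ‖ 0^a`, `x ∈ {0,1}ⁿ`, are exactly the labels with target
bit `b` and clean ancillas": `Σₓ [z = layout x b] = [z_tgt = b ∧ z_anc = 0]`. [cite: GossetKothariWu2024, Lemma 2.1 (arXiv p. 8)] -/
theorem sum_ite_eq_layout {R : Type*} [AddCommMonoid R] (c : R) (z : QReg (n + (1 + a))) (b : Bool) :
    (∑ x : QReg n, if z = layout x b then c else 0) =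
      if z (tgtWire n a) = b ∧ ∀ j, z (ancWire n a j) = false then c else 0 := by
  by_cases hP : z (tgtWire n a) = b ∧ ∀ j, z (ancWire n a j) = false
  · rw [if_pos hP, Finset.sum_eq_single (fun i => z (addrWire n a i))]
    · rw [if_pos ((eq_layout_iff z _ b).2 ⟨rfl, hP⟩)]
    · intro x _ hx
      exact if_neg fun h => hx ((eq_layout_iff z x b).1 h).1.symm
    · intro h; exact absurd (Finset.mem_univ _) h
  · rw [if_neg hP]
    exact Finset.sum_eq_zero fun x _ => if_neg fun h => hP ((eq_layout_iff z x b).1 h).2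

end Layout

open Finset


/-! ### Generic program lemmas: commuting with an untouched wire, Toffoli counts

(Uncomputation by reversal is `clEval_reverse_clEval` of `RevUncompute.lean`.) -/

section ProgramLemmas

variable {ι : Type*} [DecidableEq ι]

/-- An operation that neither targets nor reads wire `t` commutes with rewriting `t`.
[cite: NielsenChuang2010, §3.2.5] -/
theorem ClOp.eval_update_of_ne (op : ClOp ι) {t : ι} (ht : op.target ≠ t) (hc : t ∉ op.controls)
    (w : ι → Bool) (b : Bool) : op.eval (Function.update w t b) = Function.update (op.eval w) t b := by
  have hg : op.guard (Function.update w t b) = op.guard w :=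
    ClOp.guard_congr op fun c hcm => Function.update_of_ne (ne_of_mem_of_not_mem hcm hc) _ _
  unfold ClOp.eval
  rw [hg, Function.update_of_ne ht, Function.update_comm (Ne.symm ht)]

/-- A program that neither targets nor reads wire `t` commutes with rewriting `t`.
[cite: NielsenChuang2010, §3.2.5] -/
theorem clEval_update_of_forall_ne (ops : List (ClOp ι)) {t : ι}
    (h : ∀ op ∈ ops, op.target ≠ t ∧ t ∉ op.controls) (w : ι → Bool) (b : Bool) :
    clEval ops (Function.update w t b) = Function.update (clEval ops w) t b := by
  induction ops generalizing w with
  | nil => rfl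
  | cons op ops ih =>
    rw [clEval_cons, clEval_cons, ClOp.eval_update_of_ne op (h op (by simp)).1 (h op (by simp)).2,
      ih (fun o ho => h o (List.mem_cons_of_mem _ ho))]

/-- The predicate "is a Toffoli gate" on classical operations. [cite: GossetKothariWu2024, Remark 2.2 (arXiv p. 8)] -/
def ClOp.isToff : ClOp ι → Bool
  | .toffoli _ _ _ => true
  | _ => false

omit [DecidableEq ι] in
/-- Re-indexing preserves the gate type. [cite: GossetKothariWu2024, Remark 2.2 (arXiv p. 8)] -/
@[simp] theorem ClOp.isToff_map {κ : Type*} (f : ι → κ) (op : ClOp ι) : (op.map f).isToff = op.isToff := by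
  cases op <;> rfl

omit [DecidableEq ι] in
/-- Toffoli count of a re-indexed program. [cite: GossetKothariWu2024, Remark 2.2 (arXiv p. 8)] -/
theorem countP_isToff_map {κ : Type*} (f : ι → κ) (ops : List (ClOp ι)) :
    (ops.map (ClOp.map f)).countP ClOp.isToff = ops.countP ClOp.isToff := by
  rw [List.countP_map]
  congr 1
  funext op
  exact ClOp.isToff_map f op

/-- **The Toffoli count of the bridge** `toRevList` is the number of Toffoli operations.
[cite: GossetKothariWu2024, Remark 2.2 (arXiv p. 8)] -/
theorem toffCount_toRevList {N : ℕ} : ∀ (ops : List (ClOp (Fin N))) (h : ∀ op ∈ ops, op.WF),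
    toffCount (toRevList ops h) = ops.countP ClOp.isToff
  | [], _ => rfl
  | op :: ops, h => by
    rw [toRevList, List.countP_cons,
      ← toffCount_toRevList ops (fun o ho => h o (List.mem_cons_of_mem _ ho))]
    cases op <;> simp [ClOp.toRev, ClOp.isToff, toffCount]

end ProgramLemmas


namespace BoolOracle

/-! ### XOR bookkeeping in `ZMod 2` -/

section Xor

/-- A bit as an element of `ZMod 2`. [cite: GossetKothariWu2024, Remark 2.2 (arXiv p. 8)] -/
def bz (b : Bool) : ZMod 2 := if b then 1 else 0

/-- `1 ↦ 1`. [cite: GossetKothariWu2024, Remark 2.2 (arXiv p. 8)] -/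
@[simp] theorem bz_true : bz true = 1 := rfl
/-- `0 ↦ 0`. [cite: GossetKothariWu2024, Remark 2.2 (arXiv p. 8)] -/
@[simp] theorem bz_false : bz false = 0 := rfl

/-- XOR is addition mod `2`. [cite: GossetKothariWu2024, Remark 2.2 (arXiv p. 8)] -/
theorem bz_xor (a b : Bool) : bz (a ^^ b) = bz a + bz b := by
  cases a <;> cases b <;> decide

/-- AND is multiplication mod `2`. [cite: GossetKothariWu2024, Remark 2.2 (arXiv p. 8)] -/
theorem bz_and (a b : Bool) : bz (a && b) = bz a * bz b := by
  cases a <;> cases b <;> decide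

/-- `bz` is injective. [cite: GossetKothariWu2024, Remark 2.2 (arXiv p. 8)] -/
theorem bz_injective : Function.Injective bz := by
  intro a b h; cases a <;> cases b <;> first | rfl | exact absurd h (by decide)

/-- Every element of `ZMod 2` is a bit. [cite: GossetKothariWu2024, Remark 2.2 (arXiv p. 8)] -/
theorem bz_decide_eq_one (z : ZMod 2) : bz (decide (z = 1)) = z := by
  fin_cases z <;> decide

/-- The XOR of a list of bits. [cite: GossetKothariWu2024, Remark 2.2 (arXiv p. 8)] -/
def listXor (l : List Bool) : Bool := l.foldr (fun a b => a ^^ b) false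

/-- XOR of the empty list. [cite: GossetKothariWu2024, Remark 2.2 (arXiv p. 8)] -/
@[simp] theorem listXor_nil : listXor [] = false := rfl
/-- XOR of a cons. [cite: GossetKothariWu2024, Remark 2.2 (arXiv p. 8)] -/
@[simp] theorem listXor_cons (a : Bool) (l : List Bool) : listXor (a :: l) = (a ^^ listXor l) := rfl

/-- The XOR of a list is its sum mod `2`. [cite: GossetKothariWu2024, Remark 2.2 (arXiv p. 8)] -/
theorem bz_listXor (l : List Bool) : bz (listXor l) = (l.map bz).sum := by
  induction l with
  | nil => rfl
  | cons a l ih => rw [listXor_cons, bz_xor, ih, List.map_cons, List.sum_cons]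

/-- The XOR over (a listing of) a finite set is the sum mod `2` over the set.
[cite: GossetKothariWu2024, Remark 2.2 (arXiv p. 8)] -/
theorem bz_listXor_toList {α : Type*} (s : Finset α) (g : α → Bool) :
    bz (listXor (s.toList.map g)) = ∑ a ∈ s, bz (g a) := by
  rw [bz_listXor, List.map_map, ← Finset.sum_map_toList]
  rfl

end Xor

/-! ### Monomials, supports and the algebraic normal form (Möbius inversion mod 2) -/

section ANF

variable {k : ℕ}

/-- The monomial `u^S = ∏_{i ∈ S} u_i` of a bit vector. [cite: GossetKothariWu2024, Remark 2.2 (arXiv p. 8)] -/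
def mono (u : Fin k → Bool) (S : Finset (Fin k)) : Bool := decide (∀ i ∈ S, u i = true)

/-- The support of a bit vector. [cite: GossetKothariWu2024, Remark 2.2 (arXiv p. 8)] -/
def supp (u : Fin k → Bool) : Finset (Fin k) := univ.filter fun i => u i = true

/-- The indicator vector of a set of positions. [cite: GossetKothariWu2024, Remark 2.2 (arXiv p. 8)] -/
def indVec (S : Finset (Fin k)) : Fin k → Bool := fun i => decide (i ∈ S)

/-- The empty monomial is `1`. [cite: GossetKothariWu2024, Remark 2.2 (arXiv p. 8)] -/
@[simp] theorem mono_empty (u : Fin k → Bool) : mono u ∅ = true := by simp [mono]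

/-- Splitting off one variable of a monomial: `u^S = u^{S∖{p}} · u_p` for `p ∈ S`.
[cite: GossetKothariWu2024, Remark 2.2 (arXiv p. 8)] -/
theorem mono_eq_erase_and (u : Fin k → Bool) {S : Finset (Fin k)} {p : Fin k} (hp : p ∈ S) :
    mono u S = (mono u (S.erase p) && u p) := by
  rcases hup : u p with _ | _
  · simp only [mono, Bool.and_false, decide_eq_false_iff_not, not_forall]
    exact ⟨p, hp, by simp [hup]⟩
  · simp only [mono, Bool.and_true]
    rw [Bool.eq_iff_iff, decide_eq_true_iff, decide_eq_true_iff]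
    constructor
    · exact fun h i hi => h i (Finset.mem_of_mem_erase hi)
    · intro h i hi
      by_cases hip : i = p
      · rw [hip, hup]
      · exact h i (Finset.mem_erase.2 ⟨hip, hi⟩)

/-- A monomial is on iff its variables lie in the support. [cite: GossetKothariWu2024, Remark 2.2 (arXiv p. 8)] -/
theorem mono_eq_decide_subset (u : Fin k → Bool) (S : Finset (Fin k)) :
    mono u S = decide (S ⊆ supp u) := by
  simp only [mono, supp, Finset.subset_iff, Finset.mem_filter, Finset.mem_univ, true_and]

/-- The indicator vector of the support is the vector. [cite: GossetKothariWu2024, Remark 2.2 (arXiv p. 8)] -/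
@[simp] theorem indVec_supp (u : Fin k → Bool) : indVec (supp u) = u := by
  funext i; simp [indVec, supp]

/-- **Möbius inversion over the Boolean cube, mod 2**: `Σ_{T ⊆ V} Σ_{T' ⊆ T} h(T') = h(V)` in
`ZMod 2` (each `T' ⊊ V` is counted `2^{|V∖T'|} ≡ 0` times). This is the identity behind the
algebraic normal form `f(x) = ⊕_{S ⊆ supp x} ⊕_{S' ⊆ S} f(1_{S'})` ("we just need to XOR some of
them"). [cite: GossetKothariWu2024, Remark 2.2 (arXiv p. 8)] -/
theorem sum_powerset_sum_powerset (V : Finset (Fin k)) (h : Finset (Fin k) → ZMod 2) :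
    ∑ T ∈ V.powerset, ∑ T' ∈ T.powerset, h T' = h V := by
  rw [Finset.sum_comm' (t' := V.powerset) (s' := fun T' => Finset.Icc T' V) (fun T T' => by
    simp only [Finset.mem_powerset, Finset.mem_Icc]
    exact ⟨fun ⟨h1, h2⟩ => ⟨⟨h2, h1⟩, h2.trans h1⟩, fun ⟨⟨h2, h1⟩, _⟩ => ⟨h1, h2⟩⟩)]
  rw [Finset.sum_eq_single V]
  · rw [Finset.sum_const, Finset.card_Icc_finset (subset_refl V), Nat.sub_self, pow_zero, one_smul]
  · intro T' hT' hne
    rw [Finset.mem_powerset] at hT'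
    rw [Finset.sum_const, Finset.card_Icc_finset hT']
    have hlt : T'.card < V.card := Finset.card_lt_card (lt_of_le_of_ne hT' hne)
    obtain ⟨j, hj⟩ : ∃ j, V.card - T'.card = j + 1 := ⟨V.card - T'.card - 1, by omega⟩
    rw [hj, nsmul_eq_mul, Nat.cast_pow, show ((2 : ℕ) : ZMod 2) = 0 from rfl,
      zero_pow (Nat.succ_ne_zero j), zero_mul]
  · intro hV; exact absurd (Finset.mem_powerset.2 (subset_refl V)) hV

/-- The algebraic-normal-form coefficient of a two-block Boolean function at the pair of
monomials `(S, T)`: `a_{S,T} = ⊕_{S' ⊆ S, T' ⊆ T} F(1_{S'}, 1_{T'})`.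
[cite: GossetKothariWu2024, Remark 2.2 (arXiv p. 8)] -/
def anfCoeff (F : (Fin k → Bool) → (Fin k → Bool) → Bool) (S T : Finset (Fin k)) : Bool :=
  decide ((∑ S' ∈ S.powerset, ∑ T' ∈ T.powerset, bz (F (indVec S') (indVec T'))) = 1)

/-- `bz` of the coefficient is the double sum. [cite: GossetKothariWu2024, Remark 2.2 (arXiv p. 8)] -/
theorem bz_anfCoeff (F : (Fin k → Bool) → (Fin k → Bool) → Bool) (S T : Finset (Fin k)) :
    bz (anfCoeff F S T) = ∑ S' ∈ S.powerset, ∑ T' ∈ T.powerset, bz (F (indVec S') (indVec T')) :=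
  bz_decide_eq_one _

/-- **The two-block algebraic normal form**:
`F(u, v) = ⊕_T v^T · (⊕_{S : a_{S,T} = 1} u^S)` — every Boolean function of `(u, v)` is the XOR,
over the monomials `v^T` of the second block, of `v^T` times an XOR of monomials `u^S` of the first
block (Shannon/Möbius expansion; "once all conjunctions … are computed, we just need to XOR some of
them for each one of the remaining Boolean functions"). [cite: GossetKothariWu2024, Remark 2.2 (arXiv p. 8)] -/
theorem listXor_mono_anf (F : (Fin k → Bool) → (Fin k → Bool) → Bool) (u v : Fin k → Bool) :
    listXor ((univ : Finset (Finset (Fin k))).toList.map fun T =>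
      mono v T && listXor (((univ : Finset (Finset (Fin k))).filter fun S => anfCoeff F S T = true).toList.map
        (mono u))) = F u v := by
  apply bz_injective
  rw [bz_listXor_toList]
  simp only [bz_and, bz_listXor_toList]
  have hmono : ∀ (w : Fin k → Bool) (S : Finset (Fin k)),
      bz (mono w S) = if S ⊆ supp w then 1 else 0 := fun w S => by
    rw [mono_eq_decide_subset]; by_cases h : S ⊆ supp w <;> simp [h]
  -- rewrite the inner filtered sum as a sum with coefficients
  have hinner : ∀ T : Finset (Fin k),
      ∑ S ∈ univ.filter (fun S => anfCoeff F S T = true), bz (mono u S) =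
        ∑ S ∈ (supp u).powerset, bz (anfCoeff F S T) := fun T => by
    rw [Finset.sum_filter]
    rw [← Finset.sum_subset (Finset.subset_univ (supp u).powerset) (fun S _ hS => by
      rw [Finset.mem_powerset] at hS
      by_cases hc : anfCoeff F S T = true
      · rw [if_pos hc, hmono, if_neg hS]
      · rw [if_neg hc])]
    refine Finset.sum_congr rfl fun S hS => ?_
    rw [Finset.mem_powerset] at hS
    by_cases hc : anfCoeff F S T = true
    · rw [if_pos hc, hmono, if_pos hS, hc, bz_true]
    · rw [if_neg hc, Bool.eq_false_iff.2 hc, bz_false]  -- hmm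
  simp_rw [hinner, hmono v, ite_mul, one_mul, zero_mul]
  rw [← Finset.sum_filter, show univ.filter (fun T => T ⊆ supp v) = (supp v).powerset by
    ext T; simp]
  simp_rw [bz_anfCoeff]
  -- `Σ_{T ⊆ V} Σ_{S ⊆ U} Σ_{S' ⊆ S} Σ_{T' ⊆ T} g S' T'`: Möbius in `S`, then in `T`
  calc ∑ T ∈ (supp v).powerset, ∑ S ∈ (supp u).powerset, ∑ S' ∈ S.powerset, ∑ T' ∈ T.powerset,
          bz (F (indVec S') (indVec T'))
      = ∑ T ∈ (supp v).powerset, ∑ T' ∈ T.powerset, ∑ S ∈ (supp u).powerset, ∑ S' ∈ S.powerset,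
          bz (F (indVec S') (indVec T')) := by
        refine Finset.sum_congr rfl fun T _ => ?_
        rw [Finset.sum_comm]
        refine Finset.sum_congr rfl fun S _ => ?_
        rw [Finset.sum_comm]
    _ = ∑ T ∈ (supp v).powerset, ∑ T' ∈ T.powerset, bz (F (indVec (supp u)) (indVec T')) := by
        refine Finset.sum_congr rfl fun T _ => Finset.sum_congr rfl fun T' _ => ?_
        exact sum_powerset_sum_powerset (supp u) (fun S' => bz (F (indVec S') (indVec T')))
    _ = bz (F (indVec (supp u)) (indVec (supp v))) :=
        sum_powerset_sum_powerset (supp v) (fun T' => bz (F (indVec (supp u)) (indVec T')))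
    _ = bz (F u v) := by rw [indVec_supp, indVec_supp]

end ANF

/-! ### The monomial table: all `2^k` conjunctions of `k` bits with `2^k − 1` Toffoli gates -/

section Table

variable {ι : Type*} {k : ℕ} [NeZero k]

/-- A chosen variable of a nonempty monomial (its least one; `0` for the empty monomial).
[cite: GossetKothariWu2024, Remark 2.2 (arXiv p. 8)] -/
def pick (S : Finset (Fin k)) : Fin k := if h : S.Nonempty then S.min' h else 0

/-- The chosen variable lies in the monomial. [cite: GossetKothariWu2024, Remark 2.2 (arXiv p. 8)] -/
theorem pick_mem {S : Finset (Fin k)} (h : S.Nonempty) : pick S ∈ S := by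
  rw [pick, dif_pos h]; exact S.min'_mem h

variable (addr : Fin k → ι) (cell : Finset (Fin k) → ι)

/-- Level `c` of the monomial table: each monomial `S` with `|S| = c` is computed into its cell by
ONE Toffoli gate from the already computed monomial `S ∖ {p}` and the variable `p = pick S`
("all conjunctions ⋀_{j∈S} x_j … computed, which takes `2^{n−d}` AND gates").
[cite: GossetKothariWu2024, Remark 2.2 (arXiv p. 8, footnote 14)] -/
noncomputable def levelOps (c : ℕ) : List (ClOp ι) :=
  ((univ : Finset (Finset (Fin k))).filter fun S => S.card = c).toList.map fun S =>
    ClOp.toffoli (cell (S.erase (pick S))) (addr (pick S)) (cell S)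

/-- Levels `1, …, c` of the monomial table. [cite: GossetKothariWu2024, Remark 2.2 (arXiv p. 8)] -/
noncomputable def levelsUpTo : ℕ → List (ClOp ι)
  | 0 => []
  | c + 1 => levelsUpTo c ++ levelOps addr cell (c + 1)

/-- **The monomial table program**: set the cell of the empty monomial to `1`, then fill the
levels `1, …, k`. [cite: GossetKothariWu2024, Remark 2.2 (arXiv p. 8)] -/
noncomputable def tableOps : List (ClOp ι) := ClOp.not (cell ∅) :: levelsUpTo addr cell k

variable {addr cell}

/-- Members of a level. [cite: GossetKothariWu2024, Remark 2.2 (arXiv p. 8)] -/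
theorem mem_levelOps_iff {c : ℕ} {op : ClOp ι} : op ∈ levelOps addr cell c ↔
    ∃ S : Finset (Fin k), S.card = c ∧ op = ClOp.toffoli (cell (S.erase (pick S))) (addr (pick S)) (cell S) := by
  simp [levelOps, eq_comm]

/-- Members of the levels. [cite: GossetKothariWu2024, Remark 2.2 (arXiv p. 8)] -/
theorem mem_levelsUpTo_iff {c : ℕ} {op : ClOp ι} : op ∈ levelsUpTo addr cell c ↔
    ∃ S : Finset (Fin k), 1 ≤ S.card ∧ S.card ≤ c ∧
      op = ClOp.toffoli (cell (S.erase (pick S))) (addr (pick S)) (cell S) := by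
  induction c with
  | zero => simp [levelsUpTo]
  | succ c ih =>
    rw [levelsUpTo, List.mem_append, ih, mem_levelOps_iff]
    constructor
    · rintro (⟨S, h1, h2, rfl⟩ | ⟨S, h1, rfl⟩)
      · exact ⟨S, h1, by omega, rfl⟩
      · exact ⟨S, by omega, by omega, rfl⟩
    · rintro ⟨S, h1, h2, rfl⟩
      by_cases hS : S.card = c + 1
      · exact Or.inr ⟨S, hS, rfl⟩
      · exact Or.inl ⟨S, h1, by omega, rfl⟩

/-- Every level is a list of Toffoli gates, one per monomial of that size: its length is the
number of such monomials. [cite: GossetKothariWu2024, Remark 2.2 (arXiv p. 8)] -/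
theorem length_levelOps (c : ℕ) :
    (levelOps addr cell c).length = ((univ : Finset (Finset (Fin k))).filter fun S => S.card = c).card := by
  rw [levelOps, List.length_map, Finset.length_toList]

/-- The levels `1, …, c` have as many gates as there are monomials `S` with `1 ≤ |S| ≤ c`.
[cite: GossetKothariWu2024, Remark 2.2 (arXiv p. 8)] -/
theorem length_levelsUpTo (c : ℕ) : (levelsUpTo addr cell c).length =
    ((univ : Finset (Finset (Fin k))).filter fun S => 1 ≤ S.card ∧ S.card ≤ c).card := by
  induction c with
  | zero =>
    rw [levelsUpTo, List.length_nil, eq_comm, Finset.card_eq_zero, Finset.filter_eq_empty_iff]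
    intro S _ h; omega
  | succ c ih =>
    rw [levelsUpTo, List.length_append, ih, length_levelOps,
      ← Finset.card_union_of_disjoint (Finset.disjoint_filter.2 fun S _ h1 h2 => by omega),
      ← Finset.filter_or]
    congr 1
    ext S
    simp only [Finset.mem_filter, Finset.mem_univ, true_and]
    omega

/-- **Gate count of the monomial table**: at most `2^k` (Toffoli) gates in the levels
("takes `2^{n−d}` AND gates"). [cite: GossetKothariWu2024, Remark 2.2 (arXiv p. 8)] -/
theorem length_levelsUpTo_le (c : ℕ) : (levelsUpTo addr cell c).length ≤ 2 ^ k := by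
  rw [length_levelsUpTo]
  calc _ ≤ (univ : Finset (Finset (Fin k))).card := Finset.card_filter_le _ _
    _ = 2 ^ k := by rw [Finset.card_univ, Fintype.card_finset, Fintype.card_fin]

/-- Toffoli count of the monomial table. [cite: GossetKothariWu2024, Remark 2.2 (arXiv p. 8)] -/
theorem countP_isToff_tableOps_le : (tableOps addr cell).countP ClOp.isToff ≤ 2 ^ k := by
  rw [tableOps, List.countP_cons]
  simp only [ClOp.isToff, Bool.false_eq_true, ite_false, Nat.add_zero]
  exact List.countP_le_length.trans (length_levelsUpTo_le k)

/-- Wires touched by the table program: targets are cells, controls are cells and variables.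
[cite: GossetKothariWu2024, Remark 2.2 (arXiv p. 8)] -/
theorem target_controls_of_mem_tableOps {op : ClOp ι} (hop : op ∈ tableOps addr cell) :
    (∃ S, op.target = cell S) ∧ ∀ c ∈ op.controls, (∃ S, c = cell S) ∨ ∃ i, c = addr i := by
  rw [tableOps, List.mem_cons, mem_levelsUpTo_iff] at hop
  rcases hop with rfl | ⟨S, -, -, rfl⟩
  · exact ⟨⟨∅, rfl⟩, fun c hc => by simp [ClOp.controls] at hc⟩
  · refine ⟨⟨S, rfl⟩, fun c hc => ?_⟩
    simp only [ClOp.controls, List.mem_cons, List.not_mem_nil, or_false] at hc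
    rcases hc with rfl | rfl
    · exact Or.inl ⟨_, rfl⟩
    · exact Or.inr ⟨_, rfl⟩

/-- The table operations are well formed (three distinct wires each).
[cite: GossetKothariWu2024, Remark 2.2 (arXiv p. 8)] -/
theorem wf_of_mem_tableOps (hcell : Function.Injective cell) (hca : ∀ S i, cell S ≠ addr i)
    {op : ClOp ι} (hop : op ∈ tableOps addr cell) : op.WF := by
  rw [tableOps, List.mem_cons, mem_levelsUpTo_iff] at hop
  rcases hop with rfl | ⟨S, h1, -, rfl⟩
  · trivial
  · have hne : S.Nonempty := Finset.card_pos.1 h1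
    refine ⟨hca _ _, fun h => ?_, fun h => hca _ _ h.symm⟩
    exact (Finset.erase_ne_self.2 (pick_mem hne)) (hcell h) |>.elim

variable [DecidableEq ι]

/-- A level does not change wires other than the cells of its size.
[cite: GossetKothariWu2024, Remark 2.2 (arXiv p. 8)] -/
theorem clEval_levelOps_apply_of_ne (c : ℕ) (w : ι → Bool) {z : ι}
    (hz : ∀ S : Finset (Fin k), S.card = c → cell S ≠ z) : clEval (levelOps addr cell c) w z = w z :=
  clEval_apply_of_forall_target_ne _ _ fun op hop => by
    obtain ⟨S, hS, rfl⟩ := mem_levelOps_iff.1 hop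
    exact hz S hS

/-- **One level of the table.** If the cells of the monomials of size `≤ c` hold their values,
the cells of larger monomials hold `0` and the variables hold `u`, then after level `c + 1` the
same holds with `c + 1` in place of `c`, and no other wire changed.
[cite: GossetKothariWu2024, Remark 2.2 (arXiv p. 8)] -/
theorem clEval_levelOps_succ (hcell : Function.Injective cell) (hca : ∀ S i, cell S ≠ addr i)
    (c : ℕ) (u : Fin k → Bool) (w : ι → Bool)
    (hu : ∀ i, w (addr i) = u i) (hle : ∀ S, S.card ≤ c → w (cell S) = mono u S)
    (hgt : ∀ S, c < S.card → w (cell S) = false) :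
    (∀ S, S.card ≤ c + 1 → clEval (levelOps addr cell (c + 1)) w (cell S) = mono u S) ∧
    (∀ S, c + 1 < S.card → clEval (levelOps addr cell (c + 1)) w (cell S) = false) ∧
    (∀ z, (∀ S, cell S ≠ z) → clEval (levelOps addr cell (c + 1)) w z = w z) := by
  set L := levelOps addr cell (c + 1) with hL
  -- no target of the level is a control of the level
  have hdisj : ∀ op ∈ L, ∀ op' ∈ L, op'.target ∉ op.controls := by
    intro op hop op' hop'
    obtain ⟨S, hS, rfl⟩ := mem_levelOps_iff.1 hop
    obtain ⟨S', hS', rfl⟩ := mem_levelOps_iff.1 hop'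
    simp only [ClOp.target, ClOp.controls, List.mem_cons, List.not_mem_nil, or_false, not_or]
    refine ⟨fun h => ?_, (hca _ _)⟩
    have := congrArg Finset.card (hcell h)
    rw [Finset.card_erase_of_mem (pick_mem (Finset.card_pos.1 (by omega))), hS] at this
    omega
  have hnd : (L.map ClOp.target).Nodup := by
    rw [hL, levelOps, List.map_map]
    refine (Finset.nodup_toList _).map fun S S' h => hcell ?_
    simpa [ClOp.target] using h
  refine ⟨fun S hS => ?_, fun S hS => ?_, fun z hz => ?_⟩
  · rcases Nat.lt_or_ge S.card (c + 1) with hlt | hge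
    · rw [clEval_levelOps_apply_of_ne (c + 1) w (fun S' hS' h => by
        have := hcell h; subst this; omega)]
      exact hle S (by omega)
    · have hSc : S.card = c + 1 := le_antisymm hS hge
      have hne : S.Nonempty := Finset.card_pos.1 (by omega)
      have hop : ClOp.toffoli (cell (S.erase (pick S))) (addr (pick S)) (cell S) ∈ L :=
        mem_levelOps_iff.2 ⟨S, hSc, rfl⟩
      have := clEval_apply_target_of_nodup L hdisj hnd w hop
      simp only [ClOp.target, ClOp.guard] at this
      rw [this, hgt S (by omega), hu, hle _ (by rw [Finset.card_erase_of_mem (pick_mem hne)]; omega),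
        Bool.false_xor, ← mono_eq_erase_and u (pick_mem hne)]
  · rw [clEval_levelOps_apply_of_ne (c + 1) w (fun S' hS' h => by
      have := hcell h; subst this; omega)]
    exact hgt S (by omega)
  · exact clEval_levelOps_apply_of_ne (c + 1) w fun S _ => hz S

/-- **The monomial table is correct**: on an assignment where all cells hold `0` and the
variables hold `u`, after `tableOps` every cell `S` holds the monomial `u^S`, and no other wire
changed. [cite: GossetKothariWu2024, Remark 2.2 (arXiv p. 8)] -/
theorem clEval_tableOps (hcell : Function.Injective cell) (hca : ∀ S i, cell S ≠ addr i)
    (u : Fin k → Bool) (w : ι → Bool) (hu : ∀ i, w (addr i) = u i)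
    (h0 : ∀ S, w (cell S) = false) :
    (∀ S, clEval (tableOps addr cell) w (cell S) = mono u S) ∧
    (∀ z, (∀ S, cell S ≠ z) → clEval (tableOps addr cell) w z = w z) := by
  -- after the initial `NOT`
  set w₀ := (ClOp.not (cell ∅)).eval w with hw₀
  have hw₀_apply : ∀ z, w₀ z = if z = cell ∅ then true else w z := fun z => by
    rw [hw₀, ClOp.eval_not]
    by_cases hz : z = cell ∅
    · rw [if_pos hz, hz, Function.update_self, h0]; rfl
    · rw [if_neg hz, Function.update_of_ne hz]
  -- invariant after the levels `1, …, c`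
  have key : ∀ c, (∀ S, S.card ≤ c → clEval (levelsUpTo addr cell c) w₀ (cell S) = mono u S) ∧
      (∀ S, c < S.card → clEval (levelsUpTo addr cell c) w₀ (cell S) = false) ∧
      (∀ z, (∀ S, cell S ≠ z) → clEval (levelsUpTo addr cell c) w₀ z = w z) := by
    intro c
    induction c with
    | zero =>
      refine ⟨fun S hS => ?_, fun S hS => ?_, fun z hz => ?_⟩
      · rw [Finset.card_eq_zero.1 (Nat.le_zero.1 hS), levelsUpTo, clEval_nil, hw₀_apply, if_pos rfl,
          mono_empty]
      · rw [levelsUpTo, clEval_nil, hw₀_apply, if_neg (fun h => ?_), h0]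
        have := hcell h; subst this; simp at hS
      · rw [levelsUpTo, clEval_nil, hw₀_apply, if_neg (hz ∅).symm]
    | succ c ih =>
      obtain ⟨ih1, ih2, ih3⟩ := ih
      have step := clEval_levelOps_succ hcell hca c u (clEval (levelsUpTo addr cell c) w₀)
        (fun i => by rw [ih3 _ (fun S => hca S i), hu]) ih1 ih2
      rw [levelsUpTo]
      simp only [clEval_append]
      exact ⟨step.1, step.2.1, fun z hz => by rw [step.2.2 z hz, ih3 z hz]⟩
  obtain ⟨k1, -, k3⟩ := key k
  refine ⟨fun S => ?_, fun z hz => ?_⟩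
  · rw [tableOps, clEval_cons]
    exact k1 S (by simpa using Finset.card_le_univ S)
  · rw [tableOps, clEval_cons]
    exact k3 z hz

end Table

/-! ### The products `v^T · g_T(u)`: one Toffoli gate per monomial of the second block -/

section Blocks

variable {ι : Type*} {k : ℕ}
variable (cellLo cellHi : Finset (Fin k) → ι) (scr tgt : ι)

/-- `CNOT`s XOR-ing the listed first-block monomial cells into the scratch wire ("we just need
to XOR some of them"; XOR gates are `CNOT`s, free). [cite: GossetKothariWu2024, Remark 2.2 (arXiv p. 8)] -/
def cnots (L : List (Finset (Fin k))) : List (ClOp ι) := L.map fun S => ClOp.cnot (cellLo S) scr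

/-- The block of the second-block monomial `T`: XOR the monomials `u^S`, `S ∈ cl T`, into the
scratch wire, one Toffoli `target ⊕= v^T · scratch`, and un-XOR the scratch wire (one AND gate
per product `x^T · g_T`). [cite: GossetKothariWu2024, Remark 2.2 (arXiv p. 8)] -/
def block (cl : Finset (Fin k) → List (Finset (Fin k))) (T : Finset (Fin k)) : List (ClOp ι) :=
  cnots cellLo scr (cl T) ++ (ClOp.toffoli (cellHi T) scr tgt :: cnots cellLo scr (cl T))

/-- All the blocks, one per monomial `T` of the second block (`2^k` Toffoli gates).
[cite: GossetKothariWu2024, Remark 2.2 (arXiv p. 8)] -/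
noncomputable def blocks (cl : Finset (Fin k) → List (Finset (Fin k))) : List (ClOp ι) :=
  (univ : Finset (Finset (Fin k))).toList.flatMap (block cellLo cellHi scr tgt cl)

variable {cellLo cellHi scr tgt}

/-- The `CNOT` accumulation has no Toffoli gate. [cite: GossetKothariWu2024, Remark 2.2 (arXiv p. 8)] -/
@[simp] theorem countP_isToff_cnots (L : List (Finset (Fin k))) :
    (cnots cellLo scr L).countP ClOp.isToff = 0 := by
  induction L with
  | nil => rfl
  | cons S L ih => rw [cnots, List.map_cons, List.countP_cons, ← cnots, ih]; rfl

/-- A block has exactly one Toffoli gate. [cite: GossetKothariWu2024, Remark 2.2 (arXiv p. 8)] -/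
@[simp] theorem countP_isToff_block (cl : Finset (Fin k) → List (Finset (Fin k))) (T : Finset (Fin k)) :
    (block cellLo cellHi scr tgt cl T).countP ClOp.isToff = 1 := by
  rw [block, List.countP_append, List.countP_cons, countP_isToff_cnots]
  simp [ClOp.isToff]

/-- The blocks have `2^k` Toffoli gates ("`2^d` AND gates"). [cite: GossetKothariWu2024, Remark 2.2 (arXiv p. 8)] -/
theorem countP_isToff_blocks (cl : Finset (Fin k) → List (Finset (Fin k))) :
    (blocks cellLo cellHi scr tgt cl).countP ClOp.isToff = 2 ^ k := by
  rw [blocks]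
  have : ∀ Ls : List (Finset (Fin k)),
      (Ls.flatMap (block cellLo cellHi scr tgt cl)).countP ClOp.isToff = Ls.length := by
    intro Ls
    induction Ls with
    | nil => rfl
    | cons T Ls ih => rw [List.flatMap_cons, List.countP_append, ih, countP_isToff_block,
        List.length_cons, add_comm]
  rw [this, Finset.length_toList, Finset.card_univ, Fintype.card_finset, Fintype.card_fin]

/-- Members of the blocks. [cite: GossetKothariWu2024, Remark 2.2 (arXiv p. 8)] -/
theorem mem_blocks_iff (cl : Finset (Fin k) → List (Finset (Fin k))) {op : ClOp ι} :
    op ∈ blocks cellLo cellHi scr tgt cl ↔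
      ∃ T, (∃ S ∈ cl T, op = ClOp.cnot (cellLo S) scr) ∨ op = ClOp.toffoli (cellHi T) scr tgt := by
  simp only [blocks, List.mem_flatMap, Finset.mem_toList, Finset.mem_univ, true_and, block, cnots,
    List.mem_append, List.mem_cons, List.mem_map]
  constructor
  · rintro ⟨T, (⟨S, hS, rfl⟩ | rfl | ⟨S, hS, rfl⟩)⟩
    · exact ⟨T, Or.inl ⟨S, hS, rfl⟩⟩
    · exact ⟨T, Or.inr rfl⟩
    · exact ⟨T, Or.inl ⟨S, hS, rfl⟩⟩
  · rintro ⟨T, (⟨S, hS, rfl⟩ | rfl)⟩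
    · exact ⟨T, Or.inl ⟨S, hS, rfl⟩⟩
    · exact ⟨T, Or.inr (Or.inl rfl)⟩

variable [DecidableEq ι]

/-- Semantics of the `CNOT` accumulation: the scratch wire receives the XOR of the listed cells.
[cite: GossetKothariWu2024, Remark 2.2 (arXiv p. 8)] -/
theorem clEval_cnots (hne : ∀ S, cellLo S ≠ scr) (L : List (Finset (Fin k))) (w : ι → Bool) :
    clEval (cnots cellLo scr L) w =
      Function.update w scr (w scr ^^ listXor (L.map fun S => w (cellLo S))) := by
  induction L generalizing w with
  | nil => simp [cnots]
  | cons S L ih =>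
    have hmap : (L.map fun S' => Function.update w scr (w scr ^^ w (cellLo S)) (cellLo S')) =
        L.map fun S' => w (cellLo S') :=
      List.map_congr_left fun S' _ => Function.update_of_ne (hne S') _ _
    rw [cnots, List.map_cons, clEval_cons, ← cnots, ih, ClOp.eval_cnot, Function.update_idem,
      Function.update_self, hmap, List.map_cons, listXor_cons, Bool.xor_assoc]

/-- **Semantics of one block**: with a clean scratch wire, the block XORs `v^T · (⊕_{S ∈ cl T} u^S)`
(read off the cells) into the target and restores the scratch wire.
[cite: GossetKothariWu2024, Remark 2.2 (arXiv p. 8)] -/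
theorem clEval_block (hLs : ∀ S, cellLo S ≠ scr) (hLt : ∀ S, cellLo S ≠ tgt) (hst : scr ≠ tgt)
    (cl : Finset (Fin k) → List (Finset (Fin k))) (T : Finset (Fin k)) (hHs : cellHi T ≠ scr)
    (w : ι → Bool) (h0 : w scr = false) :
    clEval (block cellLo cellHi scr tgt cl T) w =
      Function.update w tgt (w tgt ^^ (w (cellHi T) && listXor ((cl T).map fun S => w (cellLo S)))) := by
  rw [block, clEval_append, clEval_cons, clEval_cnots hLs, clEval_cnots hLs, ClOp.eval_toffoli, h0,
    Bool.false_xor]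
  set X := listXor ((cl T).map fun S => w (cellLo S)) with hX
  set w₁ := Function.update w scr X with hw₁
  have h1t : w₁ tgt = w tgt := Function.update_of_ne (Ne.symm hst) _ _
  have h1H : w₁ (cellHi T) = w (cellHi T) := Function.update_of_ne hHs _ _
  have h1s : w₁ scr = X := Function.update_self ..
  rw [h1t, h1H, h1s]
  set V := (w tgt ^^ (w (cellHi T) && X)) with hV
  have h2s : Function.update w₁ tgt V scr = X := by rw [Function.update_of_ne hst, h1s]
  have h2L : (fun S => Function.update w₁ tgt V (cellLo S)) = fun S => w (cellLo S) := by
    funext S; rw [Function.update_of_ne (hLt S), hw₁, Function.update_of_ne (hLs S)]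
  have hw : Function.update w scr false = w := by rw [← h0]; exact Function.update_eq_self scr w
  rw [h2s, h2L, ← hX, Bool.xor_self, hw₁, Function.update_comm hst, Function.update_idem,
    Function.update_comm (Ne.symm hst), hw]

/-- **Semantics of all blocks**: the target receives `⊕_T v^T · (⊕_{S ∈ cl T} u^S)`, everything
else (cells, scratch, variables) is unchanged. [cite: GossetKothariWu2024, Remark 2.2 (arXiv p. 8)] -/
theorem clEval_blocks (hLs : ∀ S, cellLo S ≠ scr) (hLt : ∀ S, cellLo S ≠ tgt) (hst : scr ≠ tgt)
    (hHs : ∀ T, cellHi T ≠ scr) (hHt : ∀ T, cellHi T ≠ tgt)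
    (cl : Finset (Fin k) → List (Finset (Fin k))) (w : ι → Bool) (h0 : w scr = false) :
    clEval (blocks cellLo cellHi scr tgt cl) w =
      Function.update w tgt (w tgt ^^ listXor ((univ : Finset (Finset (Fin k))).toList.map fun T =>
        w (cellHi T) && listXor ((cl T).map fun S => w (cellLo S)))) := by
  rw [blocks]
  generalize (univ : Finset (Finset (Fin k))).toList = Ls
  induction Ls generalizing w with
  | nil => simp
  | cons T Ls ih =>
    set w' := Function.update w tgt
      (w tgt ^^ (w (cellHi T) && listXor ((cl T).map fun S => w (cellLo S)))) with hw'
    have h0' : w' scr = false := by rw [hw', Function.update_of_ne hst, h0]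
    have hmap : (Ls.map fun T' => w' (cellHi T') && listXor ((cl T').map fun S => w' (cellLo S))) =
        Ls.map fun T' => w (cellHi T') && listXor ((cl T').map fun S => w (cellLo S)) := by
      refine List.map_congr_left fun T' _ => ?_
      have hH : w' (cellHi T') = w (cellHi T') := by rw [hw', Function.update_of_ne (hHt T')]
      have hL : ((cl T').map fun S => w' (cellLo S)) = (cl T').map fun S => w (cellLo S) :=
        List.map_congr_left fun S _ => by rw [hw', Function.update_of_ne (hLt S)]
      rw [hH, hL]
    have h't : w' tgt = (w tgt ^^ (w (cellHi T) && listXor ((cl T).map fun S => w (cellLo S)))) := by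
      rw [hw', Function.update_self]
    rw [List.flatMap_cons, clEval_append, clEval_block hLs hLt hst cl T (hHs T) w h0, ← hw', ih w' h0',
      hmap, h't, hw', Function.update_idem, List.map_cons, listXor_cons, Bool.xor_assoc]

end Blocks

/-! ### The oracle on `2k` address bits: structured wires, the program, transport to `Fin N` -/

section Oracle

variable (k : ℕ)

/-- The ancilla roles: a cell per monomial of the low half, a cell per monomial of the high
half, and one scratch wire. [cite: GossetKothariWu2024, Remark 2.2 (arXiv p. 8)] -/
abbrev OAnc : Type := Finset (Fin k) ⊕ (Finset (Fin k) ⊕ Unit)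

/-- The structured wire type `address (2k) ⊕ (target ⊕ ancillas)`.
[cite: GossetKothariWu2024, Lemma 2.1 (arXiv p. 8)] -/
abbrev OWire : Type := Fin (2 * k) ⊕ (Unit ⊕ OAnc k)

/-- The number of ancillas: `2^k + 2^k + 1`. [cite: GossetKothariWu2024, Remark 2.2 (arXiv p. 8)] -/
def oAncCount : ℕ := Fintype.card (OAnc k)

variable {k}

/-- The `i`-th bit of the low half of the address. [cite: GossetKothariWu2024, Remark 2.2 (arXiv p. 8)] -/
def loBit (i : Fin k) : Fin (2 * k) := ⟨i, by omega⟩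

/-- The `i`-th bit of the high half of the address. [cite: GossetKothariWu2024, Remark 2.2 (arXiv p. 8)] -/
def hiBit (i : Fin k) : Fin (2 * k) := ⟨k + i, by omega⟩

/-- Gluing a low half and a high half into an address. [cite: GossetKothariWu2024, Remark 2.2 (arXiv p. 8)] -/
def glue (u v : Fin k → Bool) : QReg (2 * k) :=
  fun i => if h : (i : ℕ) < k then u ⟨i, h⟩ else v ⟨i - k, by have := i.isLt; omega⟩

/-- An address is the gluing of its halves. [cite: GossetKothariWu2024, Remark 2.2 (arXiv p. 8)] -/
theorem glue_loBit_hiBit (x : QReg (2 * k)) : glue (fun i => x (loBit i)) (fun i => x (hiBit i)) = x := by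
  funext i
  unfold glue
  split_ifs with h
  · rfl
  · simp only [hiBit]
    congr 1
    ext; simp only; omega

/-- A Boolean function of the address as a function of the two halves.
[cite: GossetKothariWu2024, Remark 2.2 (arXiv p. 8)] -/
def splitFun (f : QReg (2 * k) → Bool) : (Fin k → Bool) → (Fin k → Bool) → Bool := fun u v => f (glue u v)

/-- Wire of a low address bit. [cite: GossetKothariWu2024, Remark 2.2 (arXiv p. 8)] -/
def owLo (i : Fin k) : OWire k := Sum.inl (loBit i)
/-- Wire of a high address bit. [cite: GossetKothariWu2024, Remark 2.2 (arXiv p. 8)] -/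
def owHi (i : Fin k) : OWire k := Sum.inl (hiBit i)
/-- The target wire. [cite: GossetKothariWu2024, Remark 2.2 (arXiv p. 8)] -/
def owTgt : OWire k := Sum.inr (Sum.inl ())
/-- Cell of a low monomial. [cite: GossetKothariWu2024, Remark 2.2 (arXiv p. 8)] -/
def owCellLo (S : Finset (Fin k)) : OWire k := Sum.inr (Sum.inr (Sum.inl S))
/-- Cell of a high monomial. [cite: GossetKothariWu2024, Remark 2.2 (arXiv p. 8)] -/
def owCellHi (T : Finset (Fin k)) : OWire k := Sum.inr (Sum.inr (Sum.inr (Sum.inl T)))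
/-- The scratch wire. [cite: GossetKothariWu2024, Remark 2.2 (arXiv p. 8)] -/
def owScr : OWire k := Sum.inr (Sum.inr (Sum.inr (Sum.inr ())))

/-- Low cells are injective in the monomial. [cite: GossetKothariWu2024, Remark 2.2 (arXiv p. 8)] -/
theorem owCellLo_injective : Function.Injective (owCellLo (k := k)) := fun S T h => by
  simpa [owCellLo] using h
/-- High cells are injective in the monomial. [cite: GossetKothariWu2024, Remark 2.2 (arXiv p. 8)] -/
theorem owCellHi_injective : Function.Injective (owCellHi (k := k)) := fun S T h => by
  simpa [owCellHi] using h
/-- Distinct wires. [cite: GossetKothariWu2024, Remark 2.2 (arXiv p. 8)] -/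
@[simp] theorem owCellLo_ne_owLo (S : Finset (Fin k)) (i : Fin k) : owCellLo S ≠ owLo i := by simp [owCellLo, owLo]
/-- Distinct wires. [cite: GossetKothariWu2024, Remark 2.2 (arXiv p. 8)] -/
@[simp] theorem owCellHi_ne_owHi (S : Finset (Fin k)) (i : Fin k) : owCellHi S ≠ owHi i := by simp [owCellHi, owHi]
/-- Distinct wires. [cite: GossetKothariWu2024, Remark 2.2 (arXiv p. 8)] -/
@[simp] theorem owCellLo_ne_owScr (S : Finset (Fin k)) : owCellLo S ≠ (owScr : OWire k) := by simp [owCellLo, owScr]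
/-- Distinct wires. [cite: GossetKothariWu2024, Remark 2.2 (arXiv p. 8)] -/
@[simp] theorem owCellLo_ne_owTgt (S : Finset (Fin k)) : owCellLo S ≠ (owTgt : OWire k) := by simp [owCellLo, owTgt]
/-- Distinct wires. [cite: GossetKothariWu2024, Remark 2.2 (arXiv p. 8)] -/
@[simp] theorem owCellHi_ne_owScr (T : Finset (Fin k)) : owCellHi T ≠ (owScr : OWire k) := by simp [owCellHi, owScr]
/-- Distinct wires. [cite: GossetKothariWu2024, Remark 2.2 (arXiv p. 8)] -/
@[simp] theorem owCellHi_ne_owTgt (T : Finset (Fin k)) : owCellHi T ≠ (owTgt : OWire k) := by simp [owCellHi, owTgt]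
/-- Distinct wires. [cite: GossetKothariWu2024, Remark 2.2 (arXiv p. 8)] -/
@[simp] theorem owCellLo_ne_owCellHi (S T : Finset (Fin k)) : owCellLo S ≠ owCellHi T := by simp [owCellLo, owCellHi]
/-- Distinct wires. [cite: GossetKothariWu2024, Remark 2.2 (arXiv p. 8)] -/
@[simp] theorem owScr_ne_owTgt : (owScr : OWire k) ≠ owTgt := by simp [owScr, owTgt]
/-- Distinct wires. [cite: GossetKothariWu2024, Remark 2.2 (arXiv p. 8)] -/
@[simp] theorem owLo_ne_owTgt (i : Fin k) : owLo i ≠ (owTgt : OWire k) := by simp [owLo, owTgt]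
/-- Distinct wires. [cite: GossetKothariWu2024, Remark 2.2 (arXiv p. 8)] -/
@[simp] theorem owHi_ne_owTgt (i : Fin k) : owHi i ≠ (owTgt : OWire k) := by simp [owHi, owTgt]

variable [NeZero k]

/-- The two monomial tables (low half into the low cells, high half into the high cells).
[cite: GossetKothariWu2024, Remark 2.2 (arXiv p. 8)] -/
noncomputable def tablesProg : List (ClOp (OWire k)) :=
  tableOps owLo owCellLo ++ tableOps owHi owCellHi

/-- The coefficient lists: for each high monomial `T`, the low monomials `S` with `a_{S,T} = 1`.
[cite: GossetKothariWu2024, Remark 2.2 (arXiv p. 8)] -/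
noncomputable def coefList (f : QReg (2 * k) → Bool) (T : Finset (Fin k)) : List (Finset (Fin k)) :=
  ((univ : Finset (Finset (Fin k))).filter fun S => anfCoeff (splitFun f) S T = true).toList

/-- **The oracle program** for `f` on the structured wires: the tables, the `2^k` product blocks,
the tables undone. [cite: GossetKothariWu2024, Remark 2.2 (arXiv p. 8)] -/
noncomputable def oracleProg (f : QReg (2 * k) → Bool) : List (ClOp (OWire k)) :=
  tablesProg ++ blocks owCellLo owCellHi owScr owTgt (coefList f) ++ (tablesProg (k := k)).reverse

/-- The structured layout `x ‖ b ‖ 0…0`. [cite: GossetKothariWu2024, Lemma 2.1 (arXiv p. 8)] -/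
def owLayout (x : QReg (2 * k)) (b : Bool) : OWire k → Bool
  | Sum.inl i => x i
  | Sum.inr (Sum.inl _) => b
  | Sum.inr (Sum.inr _) => false

omit [NeZero k] in
/-- Rewriting the target of the structured layout. [cite: GossetKothariWu2024, Lemma 2.1 (arXiv p. 8)] -/
theorem update_owLayout_owTgt (x : QReg (2 * k)) (b b' : Bool) :
    Function.update (owLayout x b) owTgt b' = owLayout x b' := by
  funext w
  rcases w with i | ⟨⟨⟩⟩ | z
  · rw [Function.update_of_ne (by simp [owTgt])]; rfl
  · exact Function.update_self ..
  · rw [Function.update_of_ne (by simp [owTgt])]; rfl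

/-- Every table operation is well formed. [cite: GossetKothariWu2024, Remark 2.2 (arXiv p. 8)] -/
theorem wf_of_mem_tablesProg {op : ClOp (OWire k)} (hop : op ∈ tablesProg) : op.WF := by
  rw [tablesProg, List.mem_append] at hop
  rcases hop with h | h
  · exact wf_of_mem_tableOps owCellLo_injective owCellLo_ne_owLo h
  · exact wf_of_mem_tableOps owCellHi_injective owCellHi_ne_owHi h

/-- The tables neither target nor read the target wire. [cite: GossetKothariWu2024, Remark 2.2 (arXiv p. 8)] -/
theorem tablesProg_avoids_owTgt {op : ClOp (OWire k)} (hop : op ∈ tablesProg) :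
    op.target ≠ owTgt ∧ owTgt ∉ op.controls := by
  rw [tablesProg, List.mem_append] at hop
  rcases hop with h | h
  · obtain ⟨⟨S, hS⟩, hc⟩ := target_controls_of_mem_tableOps h
    refine ⟨by rw [hS]; simp, fun hm => ?_⟩
    rcases hc _ hm with ⟨S', h'⟩ | ⟨i, h'⟩
    · exact owCellLo_ne_owTgt S' h'.symm
    · exact owLo_ne_owTgt i h'.symm
  · obtain ⟨⟨S, hS⟩, hc⟩ := target_controls_of_mem_tableOps h
    refine ⟨by rw [hS]; simp, fun hm => ?_⟩
    rcases hc _ hm with ⟨S', h'⟩ | ⟨i, h'⟩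
    · exact owCellHi_ne_owTgt S' h'.symm
    · exact owHi_ne_owTgt i h'.symm

/-- Every operation of the oracle program is well formed. [cite: GossetKothariWu2024, Remark 2.2 (arXiv p. 8)] -/
theorem wf_of_mem_oracleProg (f : QReg (2 * k) → Bool) {op : ClOp (OWire k)} (hop : op ∈ oracleProg f) :
    op.WF := by
  rw [oracleProg, List.mem_append, List.mem_append, List.mem_reverse] at hop
  rcases hop with (h | h) | h
  · exact wf_of_mem_tablesProg h
  · obtain ⟨T, (⟨S, -, rfl⟩ | rfl)⟩ := (mem_blocks_iff _).1 h
    · exact owCellLo_ne_owScr S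
    · exact ⟨owCellHi_ne_owScr T, owCellHi_ne_owTgt T, owScr_ne_owTgt⟩
  · exact wf_of_mem_tablesProg h

/-- **The tables are correct** on the structured layout: low cells hold `u^S`, high cells hold
`v^T`, nothing else changes. [cite: GossetKothariWu2024, Remark 2.2 (arXiv p. 8)] -/
theorem clEval_tablesProg (x : QReg (2 * k)) (b : Bool) :
    (∀ S, clEval tablesProg (owLayout x b) (owCellLo S) = mono (fun i => x (loBit i)) S) ∧
    (∀ T, clEval tablesProg (owLayout x b) (owCellHi T) = mono (fun i => x (hiBit i)) T) ∧
    (∀ z, (∀ S, owCellLo S ≠ z) → (∀ T, owCellHi T ≠ z) → clEval tablesProg (owLayout x b) z = owLayout x b z) := by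
  obtain ⟨lo1, lo2⟩ := clEval_tableOps owCellLo_injective owCellLo_ne_owLo (fun i => x (loBit i))
    (owLayout x b) (fun i => rfl) (fun S => rfl)
  obtain ⟨hi1, hi2⟩ := clEval_tableOps owCellHi_injective owCellHi_ne_owHi (fun i => x (hiBit i))
    (clEval (tableOps owLo owCellLo) (owLayout x b))
    (fun i => by rw [lo2 _ (fun S => by simp [owCellLo, owHi])]; rfl)
    (fun T => by rw [lo2 _ (fun S => owCellLo_ne_owCellHi S T)]; rfl)
  simp only [tablesProg, clEval_append]
  refine ⟨fun S => ?_, hi1, fun z hzL hzH => ?_⟩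
  · rw [hi2 _ (fun T h => owCellLo_ne_owCellHi S T h.symm), lo1]
  · rw [hi2 z hzH, lo2 z hzL]

/-- **The oracle program computes `f` into the target** on the structured layout, restoring all
ancillas: `x ‖ b ‖ 0…0 ↦ x ‖ b ⊕ f(x) ‖ 0…0`. [cite: GossetKothariWu2024, Lemma 2.1 and Remark 2.2 (arXiv p. 8)] -/
theorem clEval_oracleProg (f : QReg (2 * k) → Bool) (x : QReg (2 * k)) (b : Bool) :
    clEval (oracleProg f) (owLayout x b) = owLayout x (b ^^ f x) := by
  obtain ⟨tLo, tHi, tElse⟩ := clEval_tablesProg x b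
  rw [oracleProg, clEval_append, clEval_append,
    clEval_blocks owCellLo_ne_owScr owCellLo_ne_owTgt owScr_ne_owTgt owCellHi_ne_owScr owCellHi_ne_owTgt
      (coefList f) _ (by rw [tElse _ owCellLo_ne_owScr owCellHi_ne_owScr]; rfl)]
  -- the XOR accumulated in the target is `f x`
  have htot : listXor ((univ : Finset (Finset (Fin k))).toList.map fun T =>
      clEval tablesProg (owLayout x b) (owCellHi T) &&
        listXor ((coefList f T).map fun S => clEval tablesProg (owLayout x b) (owCellLo S))) = f x := by
    simp only [tHi, tLo, coefList]
    rw [listXor_mono_anf (splitFun f), splitFun, glue_loBit_hiBit]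
  rw [htot, tElse _ owCellLo_ne_owTgt owCellHi_ne_owTgt,
    ← clEval_update_of_forall_ne _ (fun op hop => tablesProg_avoids_owTgt hop), update_owLayout_owTgt]
  exact clEval_reverse_clEval _ (fun op hop => wf_of_mem_tablesProg hop) _

/-- **Toffoli count of the oracle program**: at most `5 · 2^k` (`2^k` per table, `2^k` products,
tables undone). [cite: GossetKothariWu2024, Remark 2.2 (arXiv p. 8)] -/
theorem countP_isToff_oracleProg_le (f : QReg (2 * k) → Bool) :
    (oracleProg f).countP ClOp.isToff ≤ 5 * 2 ^ k := by
  have hT : (tablesProg (k := k)).countP ClOp.isToff ≤ 2 ^ k + 2 ^ k := by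
    rw [tablesProg, List.countP_append]
    exact Nat.add_le_add countP_isToff_tableOps_le countP_isToff_tableOps_le
  rw [oracleProg, List.countP_append, List.countP_append, List.countP_reverse, countP_isToff_blocks]
  omega

/-! #### Transport to the wires `Fin (2k + (1 + a))` -/

/-- The wire re-indexing `address ⊕ (target ⊕ ancillas) ≃ Fin (2k + (1 + a))` matching `layout`.
[cite: GossetKothariWu2024, Lemma 2.1 (arXiv p. 8)] -/
noncomputable def owEquiv : OWire k ≃ Fin (2 * k + (1 + oAncCount k)) :=
  (Equiv.sumCongr (Equiv.refl _)
    ((Equiv.sumCongr finOneEquiv.symm (Fintype.equivFin (OAnc k))).trans finSumFinEquiv)).trans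
    finSumFinEquiv

omit [NeZero k] in
/-- The structured layout is the pull-back of `layout`. [cite: GossetKothariWu2024, Lemma 2.1 (arXiv p. 8)] -/
theorem layout_comp_owEquiv (x : QReg (2 * k)) (b : Bool) :
    (layout (a := oAncCount k) x b) ∘ owEquiv = owLayout x b := by
  funext w
  rcases w with i | ⟨⟨⟩⟩ | z
  · simp only [Function.comp_apply, owEquiv, Equiv.trans_apply, Equiv.sumCongr_apply, Sum.map_inl,
      Equiv.refl_apply]
    exact layout_addrWire x b i
  · simp only [Function.comp_apply, owEquiv, Equiv.trans_apply, Equiv.sumCongr_apply, Sum.map_inr,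
      Sum.map_inl, finSumFinEquiv_apply_left]
    rw [show finOneEquiv.symm PUnit.unit = (0 : Fin 1) from Subsingleton.elim _ _]
    exact layout_tgtWire x b
  · simp only [Function.comp_apply, owEquiv, Equiv.trans_apply, Equiv.sumCongr_apply, Sum.map_inr,
      finSumFinEquiv_apply_right]
    exact layout_ancWire x b _

/-- The oracle program on the wires `Fin (2k + (1 + a))`. [cite: GossetKothariWu2024, Lemma 2.1 (arXiv p. 8)] -/
noncomputable def oracleFinOps (f : QReg (2 * k) → Bool) : List (ClOp (Fin (2 * k + (1 + oAncCount k)))) :=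
  (oracleProg f).map (ClOp.map owEquiv)

/-- The transported operations are well formed. [cite: GossetKothariWu2024, Lemma 2.1 (arXiv p. 8)] -/
theorem wf_of_mem_oracleFinOps (f : QReg (2 * k) → Bool) :
    ∀ op ∈ oracleFinOps f, op.WF := by
  intro op hop
  obtain ⟨op', hop', rfl⟩ := List.mem_map.1 hop
  exact (wf_of_mem_oracleProg f hop').map owEquiv.injective

/-- **The reversible oracle circuit** `U_f` over `{NOT, CNOT, Toffoli}` on `2k + (1 + a)` wires.
[cite: GossetKothariWu2024, Lemma 2.1 and Remark 2.2 (arXiv p. 8)] -/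
noncomputable def oracleRevOps (f : QReg (2 * k) → Bool) : List (RevOp (2 * k + (1 + oAncCount k))) :=
  toRevList (oracleFinOps f) (wf_of_mem_oracleFinOps f)

/-- **Correctness of the oracle circuit**: `|x⟩|b⟩|0^a⟩ ↦ |x⟩|b ⊕ f(x)⟩|0^a⟩` for all `x, b`.
[cite: GossetKothariWu2024, Lemma 2.1 (arXiv p. 8)] -/
theorem revEval_oracleRevOps (f : QReg (2 * k) → Bool) (x : QReg (2 * k)) (b : Bool) :
    revEval (oracleRevOps f) (layout x b) = layout x (xor b (f x)) := by
  rw [oracleRevOps, revEval_toRevList, oracleFinOps, clEval_map_equiv, layout_comp_owEquiv,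
    clEval_oracleProg, ← layout_comp_owEquiv x (xor b (f x))]
  funext w
  simp

/-- **Cost of the oracle circuit**: at most `5 · 2^k ≤ 8 · 2^k` Toffoli gates.
[cite: GossetKothariWu2024, Remark 2.2 (arXiv p. 8)] -/
theorem toffCount_oracleRevOps_le (f : QReg (2 * k) → Bool) : toffCount (oracleRevOps f) ≤ 8 * 2 ^ k := by
  rw [oracleRevOps, toffCount_toRevList, oracleFinOps, countP_isToff_map]
  exact (countP_isToff_oracleProg_le f).trans (by omega)

end Oracle

end BoolOracle

/-- **Exact reversible oracles with `O(2^{n/2})` Toffoli gates (S2 of the sign-state route to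
Mehraban–Tahmasbi Thm 3.1).** Every Boolean function `f` on `n = 2k` bits (`k ≥ 1`) has an exact
reversible circuit over `{NOT, CNOT, Toffoli}` computing `|x⟩|b⟩|0^a⟩ ↦ |x⟩|b ⊕ f(x)⟩|0^a⟩` for ALL
inputs (ancillas clean in and out) with at most `8 · 2^k` Toffoli gates — the multiplicative
complexity bound `O(2^{n/2})` by "expand on the first `n/2` bits, precompute all conjunctions of
the last `n/2`" (here: all monomials of both halves and one AND per product, `≤ 5 · 2^k`).
[cite: GossetKothariWu2024, Lemma 2.1 and Remark 2.2 (arXiv p. 8); LowKliuchnikovSchaeffer2024, Thm. 2] -/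
theorem boolOracle_exact (k : ℕ) (hk : 1 ≤ k) (f : QReg (2 * k) → Bool) :
    ∃ (a : ℕ) (ops : List (RevOp (2 * k + (1 + a)))),
      toffCount ops ≤ 8 * 2 ^ k ∧
        ∀ (x : QReg (2 * k)) (b : Bool), revEval ops (layout x b) = layout x (xor b (f x)) := by
  haveI : NeZero k := ⟨by omega⟩
  exact ⟨BoolOracle.oAncCount k, BoolOracle.oracleRevOps f, BoolOracle.toffCount_oracleRevOps_le f,
    BoolOracle.revEval_oracleRevOps f⟩

end Literature.Computability.QuantumComplexity
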